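import Summits.QuantumFields.YangMills.Theorems.BalabanLadderIRTwistedSlabSliceDecomposition
import Summits.QuantumFields.YangMills.Theorems.BalabanLadderIRTwistedSlabRealSlice
import HarnessLib

/-!
# The REAL Hodge decomposition at a twist-eating vacuum: `su(N)`-gauge modes ⊕ real Coulomb slice = all `su(N)`-valued fluctuations, as an
# `ℝ`-linear equivalence `(φ, y) ↦ ∇⁺φ + y` (the tangent isomorphism of the slice chart M1b in its real form)

HELPER toward stub **T1** `TwistedSlabAnchor` (LINE `twisted-slab-continuity`, crux `IRcof` stmt-QuantumFields-26930, census row 43;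
LEAD prover ym-ir-line-tsc-p1 g3; `--supports` the crux, `--as helper`).  Sequel of K11 (`gaugeSliceEquiv`, over `ℂ` on traceless fields) and K13 (`suFields`,
`realCoulombSlice`).  Method: the antilinear involution `σ Φ = −Φᴴ` commutes with the covariant differences at a unitary background, so the complex Hodge
decomposition of a `σ`-fixed (skew-Hermitian) fluctuation has `σ`-fixed components (uniqueness).
* §1 `skewInv` (`σ`), `skewInv_skewInv`, `covShift_skewInv`, `covDeriv_skewInv`, `covShiftAdj_skewInv`, `trace_skewInv`.
* §2 `toTraceless`, `toKerCovDiv` (embedding the real data into K11's complex data), ★★ `realGaugeSliceEquiv` :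
  `(suFields × realCoulombSlice (ladderField ![A, B, Γ₂, Γ₃])) ≃ₗ[ℝ] (Fin 4 → suFields)` with `realGaugeSliceEquiv_apply : (φ, y) ↦ (μ ↦ ∇⁺_μ φ + y μ)` — at the
  twist-eating ladder (`A, B` unitary Weyl pair, `ω` primitive, `N(m+1) ≥ 2`, unitary phase-flat ladder).  This is the differential of the tubular coordinates
  `(g, y) ↦ g • (e^{y}·L)` at `(1, 0)` read on REAL tangent spaces (`T_1 𝒢 = su^V`, `V = ` real Coulomb slice, `T_L SU(N)^E ≅ su^E`), an isomorphism —
  the inverse-function-theorem input of M1b in final form (with K12's `fderiv_orbitFluct_zero_apply_of_unitary`).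
NOT here: the log chart, IFT, Haar densities, `hchart` (rest of M1b); M3; M4; T1-box 0∕1, T1 proper 0∕1.

HONEST FRAMING: finite-dimensional linear algebra on one box; nothing here bears on `IRcof`, `IR`, or the Yang–Mills mass gap (Clay: NOT proved); R4 =
`BalabanLadder.UV` only.  References: M. García Pérez, A. González-Arroyo, M. Okawa, JHEP 10 (2017) 150 §2.2, §2.5; I. Montvay, G. Münster, *Quantum Fields on a
Lattice* §3.2.5.
-/

set_option autoImplicit false

noncomputable section

open scoped Matrix
open Finset
open Literature.MathematicalPhysics.QuantumFieldTheory Literature.MathematicalPhysics.QuantumLattice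
open Literature.Analysis.OperatorTheory

namespace Summit.QuantumFields.YangMills.Cruxes.IRcof.TwistedSlab

variable {N : ℕ} {n₀ n₁ n₂ n₃ : ℕ}

/-! ## §1 The involution `σ Φ = −Φᴴ` commutes with the covariant differences -/

section Involution

/-- The antilinear involution `σ Φ (x) = −(Φ x)ᴴ` whose fixed points are the skew-Hermitian fields. [folklore] -/
def skewInv (Φ : FinTorusSite n₀ n₁ n₂ n₃ → Matrix (Fin N) (Fin N) ℂ) : FinTorusSite n₀ n₁ n₂ n₃ → Matrix (Fin N) (Fin N) ℂ := fun x => -(Φ x)ᴴ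

/-- `σ` is an involution. [folklore] -/
theorem skewInv_skewInv (Φ : FinTorusSite n₀ n₁ n₂ n₃ → Matrix (Fin N) (Fin N) ℂ) : skewInv (skewInv Φ) = Φ := by
  funext x; simp [skewInv]

/-- Skew-Hermitian fields are `σ`-fixed. [folklore] -/
theorem skewInv_eq_self_of_skew {Φ : FinTorusSite n₀ n₁ n₂ n₃ → Matrix (Fin N) (Fin N) ℂ} (hΦ : ∀ x, (Φ x)ᴴ = -Φ x) : skewInv Φ = Φ := by
  funext x; rw [skewInv, hΦ, neg_neg]

/-- A `σ`-fixed field is skew-Hermitian. [folklore] -/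
theorem skew_of_skewInv_eq_self {Φ : FinTorusSite n₀ n₁ n₂ n₃ → Matrix (Fin N) (Fin N) ℂ} (hΦ : skewInv Φ = Φ) (x : FinTorusSite n₀ n₁ n₂ n₃) :
    (Φ x)ᴴ = -Φ x := by
  have h := congrFun hΦ x
  rw [skewInv] at h
  exact neg_eq_iff_eq_neg.mp h

/-- `σ` preserves tracelessness. [folklore] -/
theorem trace_skewInv {Φ : FinTorusSite n₀ n₁ n₂ n₃ → Matrix (Fin N) (Fin N) ℂ} (hΦ : ∀ x, (Φ x).trace = 0) (x : FinTorusSite n₀ n₁ n₂ n₃) :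
    (skewInv Φ x).trace = 0 := by
  rw [skewInv, Matrix.trace_neg, Matrix.trace_conjTranspose, hΦ, star_zero, neg_zero]

/-- `σ` is additive. [folklore] -/
theorem skewInv_add (Φ Ψ : FinTorusSite n₀ n₁ n₂ n₃ → Matrix (Fin N) (Fin N) ℂ) : skewInv (Φ + Ψ) = skewInv Φ + skewInv Ψ := by
  funext x; simp [skewInv, Matrix.conjTranspose_add]; abel

variable {U : FinTorusSite n₀ n₁ n₂ n₃ × Fin 4 → Matrix (Fin N) (Fin N) ℂ}

/-- `σ` commutes with the covariant shift. [folklore] -/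
theorem covShift_skewInv (μ : Fin 4) (Φ : FinTorusSite n₀ n₁ n₂ n₃ → Matrix (Fin N) (Fin N) ℂ) :
    covShift U μ (skewInv Φ) = skewInv (covShift U μ Φ) := by
  funext x
  simp only [covShift, skewInv, Matrix.conjTranspose_mul, Matrix.conjTranspose_conjTranspose, Matrix.mul_neg, Matrix.neg_mul, Matrix.mul_assoc]

/-- `σ` commutes with the forward covariant difference. [folklore] -/
theorem covDeriv_skewInv (μ : Fin 4) (Φ : FinTorusSite n₀ n₁ n₂ n₃ → Matrix (Fin N) (Fin N) ℂ) :
    covDeriv U μ (skewInv Φ) = skewInv (covDeriv U μ Φ) := by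
  funext x
  have h := congrFun (covShift_skewInv (U := U) μ Φ) x
  simp only [covDeriv, h, skewInv, Matrix.conjTranspose_sub, neg_sub]
  abel

/-- `σ` commutes with the adjoint covariant shift. [folklore] -/
theorem covShiftAdj_skewInv (μ : Fin 4) (Ψ : FinTorusSite n₀ n₁ n₂ n₃ → Matrix (Fin N) (Fin N) ℂ) :
    covShiftAdj U μ (skewInv Ψ) = skewInv (covShiftAdj U μ Ψ) := by
  funext x
  simp only [covShiftAdj, skewInv, Matrix.conjTranspose_mul, Matrix.conjTranspose_conjTranspose, Matrix.mul_neg, Matrix.neg_mul, Matrix.mul_assoc]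

/-- `σ` commutes with the covariant divergence (applied componentwise). [folklore] -/
theorem covDiv_skewInv (a : Fin 4 → FinTorusSite n₀ n₁ n₂ n₃ → Matrix (Fin N) (Fin N) ℂ) (x : FinTorusSite n₀ n₁ n₂ n₃) :
    covDiv U (fun μ => skewInv (a μ)) x = -(covDiv U a x)ᴴ := by
  simp only [covDiv, covShiftAdj_skewInv, Matrix.conjTranspose_sum, Matrix.conjTranspose_sub, neg_sub, Finset.sum_sub_distrib]
  simp only [skewInv, Finset.sum_neg_distrib]
  abel

end Involution

/-! ## §2 The real Hodge equivalence at the twist-eating ladder -/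

section RealHodge

variable [NeZero N] {m n₂' n₃' : ℕ} {A B : Matrix (Fin N) (Fin N) ℂ} {ω : ℂ} {Γ₂ Γ₃ : Matrix (Fin N) (Fin N) ℂ}

/-- Embedding `suFields ↪ tracelessFields` (forget skewness). [folklore] -/
def toTraceless (Φ : suFields N (m + 1) (m + 1) n₂' n₃') : tracelessFields N (m + 1) (m + 1) n₂' n₃' :=
  ⟨(Φ : FinTorusSite (m + 1) (m + 1) n₂' n₃' → Matrix (Fin N) (Fin N) ℂ), fun x => (Φ.2 x).2⟩

/-- Embedding of the real Coulomb slice into K11's complex kernel of the divergence. [folklore] -/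
def toKerCovDiv (hU : ∀ e, ladderField (n₀ := m + 1) (n₁ := m + 1) (n₂ := n₂') (n₃ := n₃') ![A, B, Γ₂, Γ₃] e ∈ Matrix.unitaryGroup (Fin N) ℂ)
    (y : realCoulombSlice (ladderField (n₀ := m + 1) (n₁ := m + 1) (n₂ := n₂') (n₃ := n₃') ![A, B, Γ₂, Γ₃])) :
    LinearMap.ker (DiscreteWeitzenboeck.covDiv (tracelessDadj hU)) :=
  ⟨fun μ => ⟨(y : Fin 4 → FinTorusSite (m + 1) (m + 1) n₂' n₃' → Matrix (Fin N) (Fin N) ℂ) μ, fun x => ((y.2).1 μ x).2⟩, by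
    rw [LinearMap.mem_ker]
    apply Subtype.ext
    funext x
    rw [DiscreteWeitzenboeck.covDiv_apply, Submodule.coe_sum, Finset.sum_apply]
    simp only [coe_tracelessDadj]
    have h := (y.2).2 x
    simp only [covDiv] at h
    rw [ZeroMemClass.coe_zero, Pi.zero_apply]
    exact h⟩

/-- The real decomposition map `(φ, y) ↦ (μ ↦ ∇⁺_μ φ + y μ)` agrees with K11's `gaugeSliceEquiv` on the embedded data. [folklore] -/
theorem coe_gaugeSliceEquiv_toTraceless (hAu : A ∈ Matrix.unitaryGroup (Fin N) ℂ) (hBu : B ∈ Matrix.unitaryGroup (Fin N) ℂ) (hω : IsPrimitiveRoot ω N)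
    (hAB : A * B = ω • (B * A)) (hNm : 2 ≤ N * (m + 1))
    (hU : ∀ e, ladderField (n₀ := m + 1) (n₁ := m + 1) (n₂ := n₂') (n₃ := n₃') ![A, B, Γ₂, Γ₃] e ∈ Matrix.unitaryGroup (Fin N) ℂ)
    (φ : suFields N (m + 1) (m + 1) n₂' n₃') (y : realCoulombSlice (ladderField (n₀ := m + 1) (n₁ := m + 1) (n₂ := n₂') (n₃ := n₃') ![A, B, Γ₂, Γ₃]))
    (μ : Fin 4) :
    ((gaugeSliceEquiv hAu hBu hω hAB hNm hU (toTraceless φ, toKerCovDiv hU y) μ : tracelessFields N (m + 1) (m + 1) n₂' n₃') :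
        FinTorusSite (m + 1) (m + 1) n₂' n₃' → Matrix (Fin N) (Fin N) ℂ) =
      covDeriv (ladderField ![A, B, Γ₂, Γ₃]) μ (φ : FinTorusSite (m + 1) (m + 1) n₂' n₃' → Matrix (Fin N) (Fin N) ℂ) +
        (y : Fin 4 → FinTorusSite (m + 1) (m + 1) n₂' n₃' → Matrix (Fin N) (Fin N) ℂ) μ := by
  rw [coe_gaugeSliceEquiv_apply]
  rfl

/-- ★★ **THE REAL HODGE EQUIVALENCE AT THE TWIST EATER**: `(φ, y) ↦ (μ ↦ ∇⁺_μ φ + y μ)` is an `ℝ`-linear equivalence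
`suFields × realCoulombSlice L ≃ (Fin 4 → suFields)` for the twist-eating ladder `L = ladderField ![A, B, Γ₂, Γ₃]` (`A, B` a unitary Weyl pair, `ω` primitive,
`N(m+1) ≥ 2`, unitary phase-flat ladder) — infinitesimal `su(N)` gauge transformations ⊕ the real Coulomb slice exhaust the `su(N)`-valued fluctuations, uniquely.
[cite: GarciaperezGonzalezarroyoOkawa2017, §2.2, §2.5] [cite: MontvayMunster1994, §3.2.5 p. 122] -/
def realGaugeSliceEquiv (hAu : A ∈ Matrix.unitaryGroup (Fin N) ℂ) (hBu : B ∈ Matrix.unitaryGroup (Fin N) ℂ) (hω : IsPrimitiveRoot ω N)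
    (hAB : A * B = ω • (B * A)) (hNm : 2 ≤ N * (m + 1))
    (hU : ∀ e, ladderField (n₀ := m + 1) (n₁ := m + 1) (n₂ := n₂') (n₃ := n₃') ![A, B, Γ₂, Γ₃] e ∈ Matrix.unitaryGroup (Fin N) ℂ) :
    (suFields N (m + 1) (m + 1) n₂' n₃' × realCoulombSlice (ladderField (n₀ := m + 1) (n₁ := m + 1) (n₂ := n₂') (n₃ := n₃') ![A, B, Γ₂, Γ₃])) ≃ₗ[ℝ]
      (Fin 4 → suFields N (m + 1) (m + 1) n₂' n₃') := by
  classical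
  -- the linear map
  let F : (suFields N (m + 1) (m + 1) n₂' n₃' × realCoulombSlice (ladderField (n₀ := m + 1) (n₁ := m + 1) (n₂ := n₂') (n₃ := n₃') ![A, B, Γ₂, Γ₃])) →ₗ[ℝ]
      (Fin 4 → suFields N (m + 1) (m + 1) n₂' n₃') :=
    { toFun := fun p μ => ⟨covDeriv (ladderField ![A, B, Γ₂, Γ₃]) μ (p.1 : FinTorusSite (m + 1) (m + 1) n₂' n₃' → Matrix (Fin N) (Fin N) ℂ) +
          (p.2 : Fin 4 → FinTorusSite (m + 1) (m + 1) n₂' n₃' → Matrix (Fin N) (Fin N) ℂ) μ,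
        (suFields N (m + 1) (m + 1) n₂' n₃').add_mem (covDeriv_mem_suFields hU μ p.1.2) ((p.2.2).1 μ)⟩
      map_add' := fun p q => by
        funext μ; apply Subtype.ext; funext x
        simp only [Prod.fst_add, Prod.snd_add, Submodule.coe_add, Pi.add_apply, covDeriv, covShift, Matrix.mul_add, Matrix.add_mul]
        abel
      map_smul' := fun c p => by
        funext μ; apply Subtype.ext; funext x
        simp only [Prod.smul_fst, Prod.smul_snd, Submodule.coe_smul, Pi.smul_apply, Pi.add_apply, RingHom.id_apply, smul_add, covDeriv, covShift,
          Matrix.mul_smul, Matrix.smul_mul, smul_sub] }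
  refine LinearEquiv.ofBijective F ⟨?_, ?_⟩
  · -- injectivity, through K11
    intro p q hpq
    have hsub : F (p - q) = 0 := by rw [map_sub, hpq, sub_self]
    suffices h : p - q = 0 by exact sub_eq_zero.1 h
    set r := p - q with hr
    have hE : gaugeSliceEquiv hAu hBu hω hAB hNm hU (toTraceless r.1, toKerCovDiv hU r.2) = 0 := by
      funext μ; apply Subtype.ext
      rw [coe_gaugeSliceEquiv_toTraceless]
      have h := congrArg (fun f : Fin 4 → suFields N (m + 1) (m + 1) n₂' n₃' => ((f μ : suFields N (m + 1) (m + 1) n₂' n₃') :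
        FinTorusSite (m + 1) (m + 1) n₂' n₃' → Matrix (Fin N) (Fin N) ℂ)) hsub
      exact h
    have h0 : (toTraceless r.1, toKerCovDiv hU r.2) =
        (0 : tracelessFields N (m + 1) (m + 1) n₂' n₃' × LinearMap.ker (DiscreteWeitzenboeck.covDiv (tracelessDadj hU))) :=
      (gaugeSliceEquiv hAu hBu hω hAB hNm hU).injective (by rw [hE, map_zero])
    rw [Prod.mk_eq_zero] at h0
    obtain ⟨h1, h2⟩ := h0
    have e1 : r.1 = 0 := by
      apply Subtype.ext
      have h := congrArg Subtype.val h1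
      exact h
    have e2 : r.2 = 0 := by
      apply Subtype.ext
      funext μ
      have h := congrArg (fun z : LinearMap.ker (DiscreteWeitzenboeck.covDiv (tracelessDadj hU)) =>
        (((z : Fin 4 → tracelessFields N (m + 1) (m + 1) n₂' n₃') μ : tracelessFields N (m + 1) (m + 1) n₂' n₃') :
          FinTorusSite (m + 1) (m + 1) n₂' n₃' → Matrix (Fin N) (Fin N) ℂ)) h2
      exact h
    exact Prod.ext e1 e2
  · -- surjectivity, through K11 and the involution
    intro a
    set E := gaugeSliceEquiv hAu hBu hω hAB hNm hU with hEdef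
    set a' : Fin 4 → tracelessFields N (m + 1) (m + 1) n₂' n₃' := fun μ => toTraceless (a μ) with ha'
    obtain ⟨φ', y'⟩ := E.symm a'
    have hsol : E (E.symm a') = a' := E.apply_symm_apply a'
    set q := E.symm a' with hq
    -- components of the complex decomposition
    have hcomp : ∀ μ x, covDeriv (ladderField ![A, B, Γ₂, Γ₃]) μ (q.1 : FinTorusSite (m + 1) (m + 1) n₂' n₃' → Matrix (Fin N) (Fin N) ℂ) x +
        (((q.2 : Fin 4 → tracelessFields N (m + 1) (m + 1) n₂' n₃') μ : tracelessFields N (m + 1) (m + 1) n₂' n₃') :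
          FinTorusSite (m + 1) (m + 1) n₂' n₃' → Matrix (Fin N) (Fin N) ℂ) x =
        ((a μ : suFields N (m + 1) (m + 1) n₂' n₃') : FinTorusSite (m + 1) (m + 1) n₂' n₃' → Matrix (Fin N) (Fin N) ℂ) x := by
      intro μ x
      have h := congrArg (fun f : Fin 4 → tracelessFields N (m + 1) (m + 1) n₂' n₃' =>
        ((f μ : tracelessFields N (m + 1) (m + 1) n₂' n₃') : FinTorusSite (m + 1) (m + 1) n₂' n₃' → Matrix (Fin N) (Fin N) ℂ) x) hsol
      rw [show E q = E (q.1, q.2) from rfl, coe_gaugeSliceEquiv_apply] at h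
      exact h
    -- the σ-transformed decomposition also solves; by injectivity it coincides, so the components are skew
    let φσ : tracelessFields N (m + 1) (m + 1) n₂' n₃' := ⟨skewInv (q.1 : FinTorusSite (m + 1) (m + 1) n₂' n₃' → Matrix (Fin N) (Fin N) ℂ),
      fun x => trace_skewInv q.1.2 x⟩
    let yσ : LinearMap.ker (DiscreteWeitzenboeck.covDiv (tracelessDadj hU)) :=
      ⟨fun μ => ⟨skewInv ((((q.2 : Fin 4 → tracelessFields N (m + 1) (m + 1) n₂' n₃') μ : tracelessFields N (m + 1) (m + 1) n₂' n₃') :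
          FinTorusSite (m + 1) (m + 1) n₂' n₃' → Matrix (Fin N) (Fin N) ℂ)),
        fun x => trace_skewInv ((q.2 : Fin 4 → tracelessFields N (m + 1) (m + 1) n₂' n₃') μ).2 x⟩, by
        rw [LinearMap.mem_ker]
        apply Subtype.ext
        funext x
        rw [DiscreteWeitzenboeck.covDiv_apply, Submodule.coe_sum, Finset.sum_apply, ZeroMemClass.coe_zero, Pi.zero_apply]
        simp only [coe_tracelessDadj]
        have hk := q.2.2
        rw [LinearMap.mem_ker] at hk
        have hk' := congrArg (fun z : tracelessFields N (m + 1) (m + 1) n₂' n₃' => (z : FinTorusSite (m + 1) (m + 1) n₂' n₃' → Matrix (Fin N) (Fin N) ℂ) x) hk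
        rw [DiscreteWeitzenboeck.covDiv_apply, Submodule.coe_sum, Finset.sum_apply, ZeroMemClass.coe_zero, Pi.zero_apply] at hk'
        simp only [coe_tracelessDadj] at hk'
        have h := covDiv_skewInv (U := ladderField (n₀ := m + 1) (n₁ := m + 1) (n₂ := n₂') (n₃ := n₃') ![A, B, Γ₂, Γ₃])
          (fun μ => (((q.2 : Fin 4 → tracelessFields N (m + 1) (m + 1) n₂' n₃') μ : tracelessFields N (m + 1) (m + 1) n₂' n₃') :
            FinTorusSite (m + 1) (m + 1) n₂' n₃' → Matrix (Fin N) (Fin N) ℂ)) x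
        simp only [covDiv] at h hk' ⊢
        rw [h, hk', Matrix.conjTranspose_zero, neg_zero]⟩
    have hsolσ : E (φσ, yσ) = a' := by
      funext μ; apply Subtype.ext; funext x
      rw [coe_gaugeSliceEquiv_apply]
      show covDeriv (ladderField ![A, B, Γ₂, Γ₃]) μ (skewInv (q.1 : FinTorusSite (m + 1) (m + 1) n₂' n₃' → Matrix (Fin N) (Fin N) ℂ)) x +
        skewInv ((((q.2 : Fin 4 → tracelessFields N (m + 1) (m + 1) n₂' n₃') μ : tracelessFields N (m + 1) (m + 1) n₂' n₃') :
          FinTorusSite (m + 1) (m + 1) n₂' n₃' → Matrix (Fin N) (Fin N) ℂ)) x =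
        ((a μ : suFields N (m + 1) (m + 1) n₂' n₃') : FinTorusSite (m + 1) (m + 1) n₂' n₃' → Matrix (Fin N) (Fin N) ℂ) x
      rw [covDeriv_skewInv]
      have h := hcomp μ x
      have ha : ((a μ : suFields N (m + 1) (m + 1) n₂' n₃') : FinTorusSite (m + 1) (m + 1) n₂' n₃' → Matrix (Fin N) (Fin N) ℂ) x =
          -(((a μ : suFields N (m + 1) (m + 1) n₂' n₃') : FinTorusSite (m + 1) (m + 1) n₂' n₃' → Matrix (Fin N) (Fin N) ℂ) x)ᴴ := by
        rw [((a μ).2 x).1, neg_neg]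
      simp only [skewInv]
      rw [ha, ← h, Matrix.conjTranspose_add, neg_add]
    have heq : (φσ, yσ) = q := E.injective (by rw [hsolσ, ← hsol])
    -- hence skew
    have hφskew : ∀ x, ((q.1 : FinTorusSite (m + 1) (m + 1) n₂' n₃' → Matrix (Fin N) (Fin N) ℂ) x)ᴴ =
        -(q.1 : FinTorusSite (m + 1) (m + 1) n₂' n₃' → Matrix (Fin N) (Fin N) ℂ) x := by
      have h1 := congrArg (fun z : tracelessFields N (m + 1) (m + 1) n₂' n₃' × LinearMap.ker (DiscreteWeitzenboeck.covDiv (tracelessDadj hU)) =>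
        ((z.1 : tracelessFields N (m + 1) (m + 1) n₂' n₃') : FinTorusSite (m + 1) (m + 1) n₂' n₃' → Matrix (Fin N) (Fin N) ℂ)) heq
      exact skew_of_skewInv_eq_self h1
    have hyskew : ∀ μ x, (((((q.2 : Fin 4 → tracelessFields N (m + 1) (m + 1) n₂' n₃') μ : tracelessFields N (m + 1) (m + 1) n₂' n₃') :
        FinTorusSite (m + 1) (m + 1) n₂' n₃' → Matrix (Fin N) (Fin N) ℂ) x)ᴴ) =
        -((((q.2 : Fin 4 → tracelessFields N (m + 1) (m + 1) n₂' n₃') μ : tracelessFields N (m + 1) (m + 1) n₂' n₃') :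
          FinTorusSite (m + 1) (m + 1) n₂' n₃' → Matrix (Fin N) (Fin N) ℂ) x) := by
      intro μ
      have h2 := congrArg (fun z : tracelessFields N (m + 1) (m + 1) n₂' n₃' × LinearMap.ker (DiscreteWeitzenboeck.covDiv (tracelessDadj hU)) =>
        ((((z.2 : Fin 4 → tracelessFields N (m + 1) (m + 1) n₂' n₃') μ : tracelessFields N (m + 1) (m + 1) n₂' n₃') :
          FinTorusSite (m + 1) (m + 1) n₂' n₃' → Matrix (Fin N) (Fin N) ℂ))) heq
      exact skew_of_skewInv_eq_self h2
    -- the divergence of the slice component vanishes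
    have hydiv : ∀ x, covDiv (ladderField (n₀ := m + 1) (n₁ := m + 1) (n₂ := n₂') (n₃ := n₃') ![A, B, Γ₂, Γ₃])
        (fun μ => (((q.2 : Fin 4 → tracelessFields N (m + 1) (m + 1) n₂' n₃') μ : tracelessFields N (m + 1) (m + 1) n₂' n₃') :
          FinTorusSite (m + 1) (m + 1) n₂' n₃' → Matrix (Fin N) (Fin N) ℂ)) x = 0 := by
      intro x
      have hk := q.2.2
      rw [LinearMap.mem_ker] at hk
      have hk' := congrArg (fun z : tracelessFields N (m + 1) (m + 1) n₂' n₃' => (z : FinTorusSite (m + 1) (m + 1) n₂' n₃' → Matrix (Fin N) (Fin N) ℂ) x) hk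
      rw [DiscreteWeitzenboeck.covDiv_apply, Submodule.coe_sum, Finset.sum_apply, ZeroMemClass.coe_zero, Pi.zero_apply] at hk'
      simp only [coe_tracelessDadj] at hk'
      simp only [covDiv]
      exact hk'
    refine ⟨(⟨(q.1 : FinTorusSite (m + 1) (m + 1) n₂' n₃' → Matrix (Fin N) (Fin N) ℂ), fun x => ⟨hφskew x, q.1.2 x⟩⟩,
      ⟨fun μ => (((q.2 : Fin 4 → tracelessFields N (m + 1) (m + 1) n₂' n₃') μ : tracelessFields N (m + 1) (m + 1) n₂' n₃') :
          FinTorusSite (m + 1) (m + 1) n₂' n₃' → Matrix (Fin N) (Fin N) ℂ),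
        ⟨fun μ x => ⟨hyskew μ x, ((q.2 : Fin 4 → tracelessFields N (m + 1) (m + 1) n₂' n₃') μ).2 x⟩, hydiv⟩⟩), ?_⟩
    funext μ; apply Subtype.ext; funext x
    exact hcomp μ x

end RealHodge

end Summit.QuantumFields.YangMills.Cruxes.IRcof.TwistedSlab

end
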